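import Summits.QuantumFields.BalabanUV.Beta.FP.MixLoopPowerCounting

/-!
# `BalabanUV.Beta.FP.MixLoopPowerCountingMass` — road «FP» (binder row D1), row **RHOA-6c′** «MASS-CURRENCY POWER COUNTING OF THE MIX LOOPS»
# (owner ruling R-FP-26, `HOME/b2b-balaban-beta-d1-p3/ROOTING-MIX.md` 2b24a95130924a32): the (MIX-2) loop of `FP/MixLoopPowerCounting` with the UNIFORM
# per-insertion letter `Σ_u Σ_w |q̇(u;b,b+w)| ≤ A∕n³` replaced by a MASS FUNCTION `m b`, and the second moment taken for the COARSE kernel obtained by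
# contracting both background insertions with the insertion weights `J` — [folklore] lattice bookkeeping on `ℤ⁴`, abstract kernels, every letter displayed

HONEST DEPENDENCY (page 1, mandatory): continuum YM on T⁴ ⇐ BetaPertH ∧ nine spine estimates (0/9 proved); BetaPertH ⇐ (D1) ∧ (D4) ∧
CAP+tail; G-an2-4 gates asym, D1 and NE2/3/4.  HONEST FRAMING (cell contract, verbatim): «discharging `BetaPertH` makes Bałaban's UV
stability UNCONDITIONAL — a real constructive-QFT result; it is NOT the continuum limit and NOT the Clay problem.»  THIS MODULE is elementary
[folklore] real analysis on `ℤ⁴` over FILE A `FP/MixLoopPowerCounting` BY NAME (`exp_leg_le`, `abs_smearedLeg_le`, `supNorm_cast_nonneg`) and the tree's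
sup-norm letters (`BlockLegs.supNorm_add_le_real`∕`supNorm_sub_le_real`∕`supNorm_nsmul_real`, `GradedBubbles.supNorm_neg`); it asserts nothing about
Bałaban's objects, cites nothing, mints no `Prop` fact, has no `def`, 0 sorry.  NOT `Mix_n = O(1)` for Bałaban's objects (row RHOA-6e assembles), NOT `hbook`,
NOT D1, NOT BetaPertH, NOT continuum, NOT Clay.

ABSOLUTE RULE (cell charter, verbatim): «No internally-minted statement may enter as a cited fact. Every hypothesis is either kernel-proved in this
package or a verbatim quotation of a PUBLISHED theorem with page reference. The manuscript(s) under audit are NOT citable for their own disputed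
steps — they are the thing under adjudication; programme-internal (2001/route/tribunal) claims are never citable.»

WHY (R-FP-26, RISK R-γ-10 located): the wall literal's averaging jets are ROOTED (an1 `AveragingHessianKernelsRooted.vhSAt (ctr n)`), RHOA-6b typed the
STRAIGHT ones; the radial kernel keeps the straight SUP letter but its per-insertion mass is NOT uniform in the insertion point (`½, n⁻¹∕2, n⁻²∕2, n⁻³∕2` on the
`n, n², n³, n⁴` bonds of tree level 1…4), so FILE A's `hq` fails at the trunk bonds while the TOTAL mass per block keeps the straight power.  The road object —
the coarse kernel `T₂(v₀,v) = Σ_{b,b′} J(b,v₀)·J(b′,v)·k₂(b,b′)` — needs only WEIGHTED mass letters; FILE A's (MIX-2) is the special case `m ≡ A∕n³`.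

THE LETTERS (all displayed in the signatures; `n ≥ 1` the blocking, `R` a radius multiplier):
* (U) the coarse rows seeing an insertion at `b`: `u ∈ U b ⟹ ‖b − n•u‖∞ ≤ R·n`;  (W) field-leg offsets `w ∈ W ⟹ ‖w‖∞ ≤ R·n` (NO cardinality letter);
* (I) the field-leg interpolation `|I c u| ≤ C_I·e^{−(δ∕n)‖c − n•u‖∞}`;
* the per-insertion MASS is written INLINE as `Σ_{u∈U b} Σ_{w∈W} |qd u b (b+w)|` — no letter on it is assumed pointwise;
* (J) reference-leg weight `|J b v₀| ≤ C_J·e^{−(δ∕n)‖b − n•v₀‖∞}`;  (J′) running-leg coarse moments `Σ_{v∈V} (1 + ‖b′ − n•v‖∞²∕n²)·|J b′ v| ≤ C_J′` (every `b′`);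
* (M) the EXPONENTIALLY WINDOWED MASS around any fine centre `p`: `Σ_{b∈S} e^{−(δ∕(2n))‖b − p‖∞}·(Σ_u Σ_w |qd u b (b+w)|) ≤ A_M` (finite insertion window `S`).
CONTENT.
* §1 [folklore] scalar helpers: `sq_div_mul_exp_le` (`(x∕n)²·e^{−(c∕n)x} ≤ 4∕c²` — the EXACT power: a square costs no power of `n` against an exponential at
  rate `∕n`), the three-point sup-norm split
  `nsmul_sub_split` (`n•(v − v₀) = (n•v − b′) + (b′ − b) + (b − n•v₀)`) and `sq_coarse_sep_le` (`‖v−v₀‖² ≤ 3n⁻²(‖b−n•v₀‖² + ‖b′−b‖² + ‖b′−n•v‖²)`).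
* §2 **`abs_mix2_le_mass`** — FILE A's pointwise shape with the mass function: `|k₂(b,b′)| ≤ M(b)·M(b′)·(C_I e^{2Rδ})²·e^{−(2δ∕n)‖b′−b‖∞}`
  (`exp_leg_le_radius`, `abs_smearedLeg_le_radius` = FILE A's two lemmas with the radius multiplier `R`).
* §3 **`coarse_mix2_secondMoment_le`** — THE MASS-CURRENCY SECOND MOMENT, n-FREE: for finite fine windows `S` (both insertions) and coarse window `V`,
  `Σ_{v∈V} ‖v − v₀‖∞²·|Σ_{b∈S} Σ_{b′∈S} J b v₀·J b′ v·k₂(b,b′)| ≤ 3·(C_I e^{2Rδ})²·C_J·C_J′·(1 + 20∕δ²)·A_M²`.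
Instance values of `C_J, C_J′, A_M, C_I` (and the powers of `n` they carry in the road's units) are row RHOA-6e's bookkeeping, not fixed here.  Provenance: road FP
OWNER b2b-balaban-beta-d1-p3 gen 7 (prover-b2b-balaban-beta-d1-p3-g7-0), 2026-08-21, row RHOA-6c′; «not in print; our bookkeeping»; no existing file touched.
-/

noncomputable section

namespace Summit.QuantumFields.BalabanUV.Beta.FP.MixLoopPowerCountingMass

open Finset Real
open scoped BigOperators
open Literature.MathematicalPhysics.QuantumFieldTheory.Balaban1983to89.Beta.DyadicShell (Pt supNorm)
open Literature.MathematicalPhysics.QuantumFieldTheory.Balaban1983to89.Beta.GradedBubbles (supNorm_neg)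
open Literature.MathematicalPhysics.QuantumFieldTheory.Balaban1983to89.Beta.BlockLegs (supNorm_sub_le_real supNorm_add_le_real supNorm_nsmul_real)
open Summit.QuantumFields.BalabanUV.Beta.FP.MixLoopPowerCounting (supNorm_cast_nonneg)

/-! ## §1 Scalar helpers -/

/-- [folklore] THE EXACT POWER: `(x∕n)²·e^{−(c∕n)·x} ≤ 4∕c²` (`c > 0`, `n ≥ 1`, `x ≥ 0`) — a square costs no power of `n` against an exponential at rate `∕n`
(from `c·y∕2 ≤ e^{c·y∕2}` at `y = x∕n`; the unscaled form `y²e^{−cy} ≤ 4∕c²` is `Literature.NumberTheory.LFunctions.NumberField.sq_mul_exp_neg_le`, not imported here). -/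
theorem sq_div_mul_exp_le {c x : ℝ} {n : ℕ} (hc : 0 < c) (hn : 1 ≤ n) (hx : 0 ≤ x) :
    (x / n) ^ 2 * Real.exp (-(c / n) * x) ≤ 4 / c ^ 2 := by
  have hn' : (0 : ℝ) < n := by exact_mod_cast hn
  set y : ℝ := x / n with hy
  have hy0 : 0 ≤ y := by positivity
  have e0 : -(c / n) * x = -(c * y) := by rw [hy]; field_simp
  rw [e0]
  have h1 : c * y / 2 ≤ Real.exp (c * y / 2) := by linarith [Real.add_one_le_exp (c * y / 2)]
  have h2 : (c * y / 2) ^ 2 ≤ Real.exp (c * y / 2) ^ 2 := pow_le_pow_left₀ (by positivity) h1 2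
  have h3 : Real.exp (c * y / 2) ^ 2 = Real.exp (c * y) := by rw [← Real.exp_nat_mul]; congr 1; ring
  rw [h3] at h2
  have h4 : y ^ 2 * Real.exp (-(c * y)) = (c * y / 2) ^ 2 / Real.exp (c * y) * (4 / c ^ 2) := by
    rw [Real.exp_neg]; field_simp; ring
  rw [h4]
  have h5 : (c * y / 2) ^ 2 / Real.exp (c * y) ≤ 1 := by rw [div_le_one (Real.exp_pos _)]; exact h2
  calc (c * y / 2) ^ 2 / Real.exp (c * y) * (4 / c ^ 2) ≤ 1 * (4 / c ^ 2) := mul_le_mul_of_nonneg_right h5 (by positivity)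
    _ = 4 / c ^ 2 := one_mul _

/-- [folklore] The three-point split of the coarse separation: `n•(v − v₀) = (n•v − b′) + (b′ − b) + (b − n•v₀)` in `ℤ⁴`. -/
theorem nsmul_sub_split (n : ℕ) (v v₀ b b' : Pt) :
    (n : ℤ) • (v - v₀) = ((n : ℤ) • v - b') + (b' - b) + (b - (n : ℤ) • v₀) := by
  rw [smul_sub]; abel

/-- [folklore] `‖n•z‖∞ = n·‖z‖∞` for the `ℤ`-scalar action (real cast). -/
theorem supNorm_zsmul_natCast_real (n : ℕ) (z : Pt) : (supNorm ((n : ℤ) • z) : ℝ) = n * supNorm z := by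
  have e : (n : ℤ) • z = n • z := natCast_zsmul z n
  rw [e, supNorm_nsmul_real]

/-- [folklore] **THE COARSE SEPARATION AGAINST THE THREE FINE SEPARATIONS**:
`n·‖v − v₀‖∞ ≤ ‖b − n•v₀‖∞ + ‖b′ − b‖∞ + ‖b′ − n•v‖∞`. -/
theorem coarse_sep_le (n : ℕ) (v v₀ b b' : Pt) :
    (n : ℝ) * supNorm (v - v₀) ≤ supNorm (b - (n : ℤ) • v₀) + supNorm (b' - b) + supNorm (b' - (n : ℤ) • v) := by
  rw [← supNorm_zsmul_natCast_real, nsmul_sub_split n v v₀ b b']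
  have h1 := supNorm_add_le_real (((n : ℤ) • v - b') + (b' - b)) (b - (n : ℤ) • v₀)
  have h2 := supNorm_add_le_real ((n : ℤ) • v - b') (b' - b)
  have h3 : (supNorm ((n : ℤ) • v - b') : ℝ) = supNorm (b' - (n : ℤ) • v) := by rw [← supNorm_neg, neg_sub]
  linarith

/-- [folklore] Squared form: `‖v − v₀‖∞² ≤ 3·((‖b − n•v₀‖∕n)² + (‖b′ − b‖∕n)² + (‖b′ − n•v‖∕n)²)` for `n ≥ 1`. -/
theorem sq_coarse_sep_le {n : ℕ} (hn : 1 ≤ n) (v v₀ b b' : Pt) :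
    (supNorm (v - v₀) : ℝ) ^ 2 ≤ 3 * (((supNorm (b - (n : ℤ) • v₀) : ℝ) / n) ^ 2 + ((supNorm (b' - b) : ℝ) / n) ^ 2
      + ((supNorm (b' - (n : ℤ) • v) : ℝ) / n) ^ 2) := by
  have hn' : (0 : ℝ) < n := by exact_mod_cast hn
  have h := coarse_sep_le n v v₀ b b'
  set x := (supNorm (b - (n : ℤ) • v₀) : ℝ); set y := (supNorm (b' - b) : ℝ)
  set z := (supNorm (b' - (n : ℤ) • v) : ℝ); set s := (supNorm (v - v₀) : ℝ)
  have hs : 0 ≤ s := supNorm_cast_nonneg _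
  have hdiv : s ≤ x / n + y / n + z / n := by rw [← add_div, ← add_div, le_div_iff₀ hn']; linarith
  calc s ^ 2 ≤ (x / n + y / n + z / n) ^ 2 := pow_le_pow_left₀ hs hdiv 2
    _ ≤ 3 * ((x / n) ^ 2 + (y / n) ^ 2 + (z / n) ^ 2) := by
        nlinarith [sq_nonneg (x / n - y / n), sq_nonneg (y / n - z / n), sq_nonneg (x / n - z / n)]

/-! ## §2 The pointwise shape with a MASS FUNCTION (FILE A's (MIX-2) with `A∕n³ ↦ m b` and radius multiplier `R`) -/

section Mix2

variable {U : Pt → Finset Pt} {W : Finset Pt} {qd : Pt → Pt → Pt → ℝ} {I J : Pt → Pt → ℝ} {C_I C_J C_J' A_M δ : ℝ} {n R : ℕ}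

/-- [folklore] FILE A's leg comparison with a radius multiplier `R`: `e^{−(δ∕n)‖b + w − n•u′‖} ≤ e^{2Rδ}·e^{−(δ∕n)‖b′ − b‖}` when `‖w‖, ‖b′ − n•u′‖ ≤ R·n`. -/
theorem exp_leg_le_radius (hδ : 0 < δ) (hn : 1 ≤ n) (hW : ∀ w ∈ W, supNorm w ≤ R * n) {b' u' w : Pt}
    (hu' : supNorm (b' - (n : ℤ) • u') ≤ R * n) (hw : w ∈ W) (b : Pt) :
    Real.exp (-(δ / n) * (supNorm (b + w - (n : ℤ) • u') : ℝ))
      ≤ Real.exp (2 * R * δ) * Real.exp (-(δ / n) * (supNorm (b' - b) : ℝ)) := by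
  have hn' : (0 : ℝ) < n := by exact_mod_cast hn
  have htri : (supNorm (b' - b) : ℝ) ≤ R * n + (supNorm (b + w - (n : ℤ) • u') : ℝ) + R * n := by
    have e : b' - b = (b' - (n : ℤ) • u') - (b + w - (n : ℤ) • u') + w := by abel
    have h1 := supNorm_add_le_real ((b' - (n : ℤ) • u') - (b + w - (n : ℤ) • u')) w
    have h2 := supNorm_sub_le_real (b' - (n : ℤ) • u') (b + w - (n : ℤ) • u')
    have h3 : (supNorm (b' - (n : ℤ) • u') : ℝ) ≤ R * n := by exact_mod_cast hu'
    have h4 : (supNorm w : ℝ) ≤ R * n := by exact_mod_cast hW w hw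
    rw [e]; linarith
  rw [← Real.exp_add]
  apply Real.exp_le_exp.mpr
  have hdn : 0 < δ / n := by positivity
  have : -(δ / n) * (supNorm (b' - b) : ℝ) ≥ -(δ / n) * (R * n + (supNorm (b + w - (n : ℤ) • u') : ℝ) + R * n) := by
    nlinarith
  have e2 : (δ / n) * (R * n) = R * δ := by field_simp
  nlinarith

/-- [folklore] One smeared interpolation leg, radius form:
`|Σ_{w∈W} q̇(u;b,b+w)·𝓘(b+w,u′)| ≤ (Σ_w |q̇(u;b,b+w)|)·C_I·e^{2Rδ}·e^{−(δ∕n)‖b′−b‖}` for `u′` seeing `b′`. -/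
theorem abs_smearedLeg_le_radius (hδ : 0 < δ) (hn : 1 ≤ n) (hW : ∀ w ∈ W, supNorm w ≤ R * n)
    (hI : ∀ c u, |I c u| ≤ C_I * Real.exp (-(δ / n) * (supNorm (c - (n : ℤ) • u) : ℝ))) {b' u' : Pt}
    (hu' : supNorm (b' - (n : ℤ) • u') ≤ R * n) (u b : Pt) :
    |∑ w ∈ W, qd u b (b + w) * I (b + w) u'|
      ≤ (∑ w ∈ W, |qd u b (b + w)|) * (C_I * Real.exp (2 * R * δ) * Real.exp (-(δ / n) * (supNorm (b' - b) : ℝ))) := by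
  have hC : 0 ≤ C_I := by
    have h := hI b u
    have : 0 < Real.exp (-(δ / n) * (supNorm (b - (n : ℤ) • u) : ℝ)) := Real.exp_pos _
    nlinarith [abs_nonneg (I b u)]
  rw [Finset.sum_mul]
  refine (Finset.abs_sum_le_sum_abs _ _).trans (Finset.sum_le_sum fun w hw => ?_)
  rw [abs_mul]
  refine mul_le_mul_of_nonneg_left ((hI _ _).trans ?_) (abs_nonneg _)
  rw [mul_assoc]
  exact mul_le_mul_of_nonneg_left (exp_leg_le_radius hδ hn hW hu' hw b) hC

/-- **(MIX-2) POINTWISE SHAPE WITH A MASS FUNCTION**: with the letters (U)(W)(I) and NO letter on the per-insertion masses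
`M(b) := Σ_{u∈U b} Σ_{w∈W} |q̇(u;b,b+w)|`,
`|k₂(b,b′)| ≤ M(b)·M(b′)·(C_I·e^{2Rδ})²·e^{−(2δ∕n)‖b′−b‖∞}`.  (FILE A's `abs_mix2_le` is the case `M ≤ A∕n³`, `R = 1`.) [folklore] -/
theorem abs_mix2_le_mass (hδ : 0 < δ) (hn : 1 ≤ n) (hU : ∀ b, ∀ u ∈ U b, supNorm (b - (n : ℤ) • u) ≤ R * n)
    (hW : ∀ w ∈ W, supNorm w ≤ R * n)
    (hI : ∀ c u, |I c u| ≤ C_I * Real.exp (-(δ / n) * (supNorm (c - (n : ℤ) • u) : ℝ))) (b b' : Pt) :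
    |∑ u ∈ U b, ∑ u' ∈ U b', (∑ w ∈ W, qd u b (b + w) * I (b + w) u') * (∑ w' ∈ W, qd u' b' (b' + w') * I (b' + w') u)|
      ≤ (∑ u ∈ U b, ∑ w ∈ W, |qd u b (b + w)|) * (∑ u' ∈ U b', ∑ w' ∈ W, |qd u' b' (b' + w')|)
          * (C_I * Real.exp (2 * R * δ)) ^ 2 * Real.exp (-(2 * δ / n) * (supNorm (b' - b) : ℝ)) := by
  set E : ℝ := C_I * Real.exp (2 * R * δ) * Real.exp (-(δ / n) * (supNorm (b' - b) : ℝ)) with hE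
  have hC : 0 ≤ C_I := by
    have h := hI b b
    have : 0 < Real.exp (-(δ / n) * (supNorm (b - (n : ℤ) • b) : ℝ)) := Real.exp_pos _
    nlinarith [abs_nonneg (I b b)]
  have hE0 : 0 ≤ E := by positivity
  set m : Pt → Pt → ℝ := fun b u => ∑ w ∈ W, |qd u b (b + w)| with hm
  have hm0 : ∀ b u, 0 ≤ m b u := fun b u => Finset.sum_nonneg fun w _ => abs_nonneg _
  have hX : ∀ u, ∀ u' ∈ U b', |∑ w ∈ W, qd u b (b + w) * I (b + w) u'| ≤ m b u * E :=
    fun u u' hu' => abs_smearedLeg_le_radius hδ hn hW hI (hU b' u' hu') u b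
  have hY : ∀ u ∈ U b, ∀ u', |∑ w' ∈ W, qd u' b' (b' + w') * I (b' + w') u| ≤ m b' u' * E := by
    intro u hu u'
    have h := abs_smearedLeg_le_radius (qd := qd) hδ hn hW hI (hU b u hu) u' b'
    have e : (supNorm (b - b') : ℝ) = supNorm (b' - b) := by rw [← supNorm_neg, neg_sub]
    rwa [e] at h
  calc |∑ u ∈ U b, ∑ u' ∈ U b', (∑ w ∈ W, qd u b (b + w) * I (b + w) u') * (∑ w' ∈ W, qd u' b' (b' + w') * I (b' + w') u)|
      ≤ ∑ u ∈ U b, ∑ u' ∈ U b', (m b u * E) * (m b' u' * E) := by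
        refine (Finset.abs_sum_le_sum_abs _ _).trans (Finset.sum_le_sum fun u hu =>
          (Finset.abs_sum_le_sum_abs _ _).trans (Finset.sum_le_sum fun u' hu' => ?_))
        rw [abs_mul]
        exact mul_le_mul (hX u u' hu') (hY u hu u') (abs_nonneg _) (mul_nonneg (hm0 b u) hE0)
    _ = E ^ 2 * ((∑ u ∈ U b, m b u) * (∑ u' ∈ U b', m b' u')) := by
        rw [Finset.sum_mul_sum, Finset.mul_sum]
        refine Finset.sum_congr rfl fun u _ => ?_
        rw [Finset.mul_sum]
        exact Finset.sum_congr rfl fun u' _ => by ring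
    _ = (∑ u ∈ U b, m b u) * (∑ u' ∈ U b', m b' u') * (C_I * Real.exp (2 * R * δ)) ^ 2
          * Real.exp (-(2 * δ / n) * (supNorm (b' - b) : ℝ)) := by
        have e2 : Real.exp (-(2 * δ / n) * (supNorm (b' - b) : ℝ)) = Real.exp (-(δ / n) * (supNorm (b' - b) : ℝ)) ^ 2 := by
          rw [sq, ← Real.exp_add]; congr 1; ring
        rw [e2, hE]; ring

/-! ## §3 The mass-currency second moment of the COARSE kernel, n-free -/

/-- **(MIX-2) COARSE SECOND MOMENT IN MASS CURRENCY, n-FREE** (R-FP-26 (b), row RHOA-6c′).  Contract both background insertions of FILE A's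
loop kernel `k₂(b,b′)` with insertion weights `J` (on the road: the minimiser `𝓘`, `Ḃ = 𝓘·v`): `T₂(v₀,v) := Σ_{b∈S} Σ_{b′∈S} J(b,v₀)·J(b′,v)·k₂(b,b′)`.
Under (U)(W)(I), the reference-leg letter (J) `|J b v₀| ≤ C_J e^{−(δ∕n)‖b−n•v₀‖}`, the running-leg coarse-moment letter (J′)
`Σ_{v∈V}(1 + (‖b′−n•v‖∕n)²)|J b′ v| ≤ C_J′`, and the exponentially windowed MASS letter (M) `Σ_{b∈S} e^{−(δ∕(2n))‖b−p‖}·M(b) ≤ A_M` (every fine centre `p`):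
`Σ_{v∈V} ‖v−v₀‖∞²·|T₂(v₀,v)| ≤ 3·(C_I e^{2Rδ})²·C_J·C_J′·(1 + 20∕δ²)·A_M²`.
The square of the coarse separation costs NO power of `n` (`sq_div_mul_exp_le`); all powers of `n` of an instance sit in its letter constants. [folklore] -/
theorem coarse_mix2_secondMoment_le (hδ : 0 < δ) (hn : 1 ≤ n)
    (hU : ∀ b, ∀ u ∈ U b, supNorm (b - (n : ℤ) • u) ≤ R * n) (hW : ∀ w ∈ W, supNorm w ≤ R * n)
    (hI : ∀ c u, |I c u| ≤ C_I * Real.exp (-(δ / n) * (supNorm (c - (n : ℤ) • u) : ℝ)))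
    (S V : Finset Pt) (v₀ : Pt)
    (hJ : ∀ b, |J b v₀| ≤ C_J * Real.exp (-(δ / n) * (supNorm (b - (n : ℤ) • v₀) : ℝ)))
    (hJ' : ∀ b', ∑ v ∈ V, (1 + ((supNorm (b' - (n : ℤ) • v) : ℝ) / n) ^ 2) * |J b' v| ≤ C_J')
    (hM : ∀ p : Pt, ∑ b ∈ S, Real.exp (-(δ / (2 * n)) * (supNorm (b - p) : ℝ)) * (∑ u ∈ U b, ∑ w ∈ W, |qd u b (b + w)|) ≤ A_M) :
    ∑ v ∈ V, (supNorm (v - v₀) : ℝ) ^ 2 *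
        |∑ b ∈ S, ∑ b' ∈ S, J b v₀ * J b' v *
          (∑ u ∈ U b, ∑ u' ∈ U b', (∑ w ∈ W, qd u b (b + w) * I (b + w) u') * (∑ w' ∈ W, qd u' b' (b' + w') * I (b' + w') u))|
      ≤ 3 * (C_I * Real.exp (2 * R * δ)) ^ 2 * C_J * C_J' * (1 + 20 / δ ^ 2) * A_M ^ 2 := by
  have hn' : (0 : ℝ) < n := by exact_mod_cast hn
  set E₀ : ℝ := (C_I * Real.exp (2 * R * δ)) ^ 2 with hE₀
  have hE₀0 : 0 ≤ E₀ := by positivity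
  set M : Pt → ℝ := fun b => ∑ u ∈ U b, ∑ w ∈ W, |qd u b (b + w)| with hMdef
  have hM0 : ∀ b, 0 ≤ M b := fun b => Finset.sum_nonneg fun u _ => Finset.sum_nonneg fun w _ => abs_nonneg _
  set k : Pt → Pt → ℝ := fun b b' =>
    ∑ u ∈ U b, ∑ u' ∈ U b', (∑ w ∈ W, qd u b (b + w) * I (b + w) u') * (∑ w' ∈ W, qd u' b' (b' + w') * I (b' + w') u) with hk
  set dx : Pt → ℝ := fun b => (supNorm (b - (n : ℤ) • v₀) : ℝ) with hdx
  set dy : Pt → Pt → ℝ := fun b b' => (supNorm (b' - b) : ℝ) with hdy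
  set dz : Pt → Pt → ℝ := fun b' v => (supNorm (b' - (n : ℤ) • v) : ℝ) with hdz
  have hdx0 : ∀ b, 0 ≤ dx b := fun b => supNorm_cast_nonneg _
  have hdy0 : ∀ b b', 0 ≤ dy b b' := fun b b' => supNorm_cast_nonneg _
  have hdz0 : ∀ b' v, 0 ≤ dz b' v := fun b' v => supNorm_cast_nonneg _
  have hCJ : 0 ≤ C_J := by
    have h := hJ ((n : ℤ) • v₀)
    have e : Real.exp (-(δ / n) * (supNorm ((n : ℤ) • v₀ - (n : ℤ) • v₀) : ℝ)) = 1 := by simp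
    exact (abs_nonneg _).trans (by rw [e, mul_one] at h; exact h)
  have hCJ' : 0 ≤ C_J' := le_trans (Finset.sum_nonneg fun v _ => by positivity) (hJ' v₀)
  -- the mass letter in terms of `M`
  have hM' : ∀ p : Pt, ∑ b ∈ S, Real.exp (-(δ / (2 * n)) * (supNorm (b - p) : ℝ)) * M b ≤ A_M := by
    intro p; simp only [hMdef]; exact hM p
  have hAM : 0 ≤ A_M := le_trans (Finset.sum_nonneg fun b _ => mul_nonneg (Real.exp_pos _).le (hM0 b)) (hM' v₀)
  have hkb : ∀ b b', |k b b'| ≤ M b * M b' * E₀ * Real.exp (-(2 * δ / n) * dy b b') := by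
    intro b b'
    have h := abs_mix2_le_mass (qd := qd) hδ hn hU hW hI b b'
    simpa [hk, hMdef, hE₀, hdy, mul_assoc, mul_comm, mul_left_comm] using h
  clear_value M -- from here on `M` is opaque
  -- STEP 1: pull the absolute value inside and use the pointwise shape
  have step1 : ∀ v ∈ V, (supNorm (v - v₀) : ℝ) ^ 2 * |∑ b ∈ S, ∑ b' ∈ S, J b v₀ * J b' v * k b b'|
      ≤ ∑ b ∈ S, ∑ b' ∈ S, (supNorm (v - v₀) : ℝ) ^ 2 * (|J b v₀| * |J b' v| * (M b * M b' * E₀ * Real.exp (-(2 * δ / n) * dy b b'))) := by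
    intro v _
    have h0 : 0 ≤ (supNorm (v - v₀) : ℝ) ^ 2 := by positivity
    have h1 : |∑ b ∈ S, ∑ b' ∈ S, J b v₀ * J b' v * k b b'|
        ≤ ∑ b ∈ S, ∑ b' ∈ S, |J b v₀| * |J b' v| * (M b * M b' * E₀ * Real.exp (-(2 * δ / n) * dy b b')) := by
      refine (Finset.abs_sum_le_sum_abs _ _).trans (Finset.sum_le_sum fun b _ =>
        (Finset.abs_sum_le_sum_abs _ _).trans (Finset.sum_le_sum fun b' _ => ?_))
      rw [abs_mul, abs_mul]
      exact mul_le_mul_of_nonneg_left (hkb b b') (by positivity)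
    calc (supNorm (v - v₀) : ℝ) ^ 2 * |∑ b ∈ S, ∑ b' ∈ S, J b v₀ * J b' v * k b b'|
        ≤ (supNorm (v - v₀) : ℝ) ^ 2 *
            ∑ b ∈ S, ∑ b' ∈ S, |J b v₀| * |J b' v| * (M b * M b' * E₀ * Real.exp (-(2 * δ / n) * dy b b')) :=
          mul_le_mul_of_nonneg_left h1 h0
      _ = _ := by
          rw [Finset.mul_sum]
          exact Finset.sum_congr rfl fun b _ => Finset.mul_sum _ _ _
  -- STEP 2: the coarse separation against the three fine separations; the squares are absorbed into half of the exponentials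
  have absorb : ∀ b b' v, (supNorm (v - v₀) : ℝ) ^ 2 * (Real.exp (-(δ / n) * dx b) * Real.exp (-(2 * δ / n) * dy b b'))
      ≤ 3 * ((16 / δ ^ 2 + 4 / δ ^ 2) + (dz b' v / n) ^ 2) *
          (Real.exp (-(δ / (2 * n)) * dx b) * Real.exp (-(δ / n) * dy b b')) := by
    intro b b' v
    have hsep := sq_coarse_sep_le hn v v₀ b b'
    have ex1 : Real.exp (-(δ / n) * dx b) = Real.exp (-(δ / (2 * n)) * dx b) * Real.exp (-(δ / (2 * n)) * dx b) := by
      rw [← Real.exp_add]; congr 1; field_simp; ring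
    have ex2 : Real.exp (-(2 * δ / n) * dy b b') = Real.exp (-(δ / n) * dy b b') * Real.exp (-(δ / n) * dy b b') := by
      rw [← Real.exp_add]; congr 1; ring
    have a1 : (dx b / n) ^ 2 * Real.exp (-(δ / (2 * n)) * dx b) ≤ 16 / δ ^ 2 := by
      have h := sq_div_mul_exp_le (c := δ / 2) (x := dx b) (by positivity) hn (hdx0 b)
      have e : -(δ / 2 / n) * dx b = -(δ / (2 * n)) * dx b := by field_simp
      rw [e] at h
      calc _ ≤ 4 / (δ / 2) ^ 2 := h
        _ = 16 / δ ^ 2 := by field_simp; ring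
    have a2 : (dy b b' / n) ^ 2 * Real.exp (-(δ / n) * dy b b') ≤ 4 / δ ^ 2 :=
      sq_div_mul_exp_le hδ hn (hdy0 b b')
    have hexA1 : Real.exp (-(δ / (2 * n)) * dx b) ≤ 1 :=
      Real.exp_le_one_iff.mpr (by have := hdx0 b; nlinarith [show 0 < δ / (2 * n) by positivity])
    have hexB1 : Real.exp (-(δ / n) * dy b b') ≤ 1 :=
      Real.exp_le_one_iff.mpr (by have := hdy0 b b'; nlinarith [show 0 < δ / n by positivity])
    rw [ex1, ex2]
    calc (supNorm (v - v₀) : ℝ) ^ 2 *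
          (Real.exp (-(δ / (2 * n)) * dx b) * Real.exp (-(δ / (2 * n)) * dx b) *
            (Real.exp (-(δ / n) * dy b b') * Real.exp (-(δ / n) * dy b b')))
        ≤ 3 * ((dx b / n) ^ 2 + (dy b b' / n) ^ 2 + (dz b' v / n) ^ 2) *
          (Real.exp (-(δ / (2 * n)) * dx b) * Real.exp (-(δ / (2 * n)) * dx b) *
            (Real.exp (-(δ / n) * dy b b') * Real.exp (-(δ / n) * dy b b'))) :=
          mul_le_mul_of_nonneg_right hsep (by positivity)
      _ = 3 * (((dx b / n) ^ 2 * Real.exp (-(δ / (2 * n)) * dx b)) * Real.exp (-(δ / n) * dy b b')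
            + ((dy b b' / n) ^ 2 * Real.exp (-(δ / n) * dy b b')) * Real.exp (-(δ / (2 * n)) * dx b)
            + (dz b' v / n) ^ 2 * (Real.exp (-(δ / (2 * n)) * dx b) * Real.exp (-(δ / n) * dy b b')))
            * (Real.exp (-(δ / (2 * n)) * dx b) * Real.exp (-(δ / n) * dy b b')) := by ring
      _ ≤ 3 * ((16 / δ ^ 2) * 1 + (4 / δ ^ 2) * 1 + (dz b' v / n) ^ 2 * (1 * 1))
            * (Real.exp (-(δ / (2 * n)) * dx b) * Real.exp (-(δ / n) * dy b b')) := by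
          apply mul_le_mul_of_nonneg_right _ (by positivity)
          apply mul_le_mul_of_nonneg_left _ (by norm_num)
          apply add_le_add (add_le_add _ _) _
          · exact mul_le_mul a1 hexB1 (Real.exp_pos _).le (by positivity)
          · exact mul_le_mul a2 hexA1 (Real.exp_pos _).le (by positivity)
          · exact mul_le_mul_of_nonneg_left (mul_le_mul hexA1 hexB1 (Real.exp_pos _).le zero_le_one) (by positivity)
      _ = _ := by ring
  -- STEP 3: for fixed b, b', sum over v using (J′)
  have step3 : ∀ b b', ∑ v ∈ V, (supNorm (v - v₀) : ℝ) ^ 2 *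
        (|J b v₀| * |J b' v| * (M b * M b' * E₀ * Real.exp (-(2 * δ / n) * dy b b')))
      ≤ (3 * (1 + 20 / δ ^ 2) * E₀ * C_J * C_J') *
          (Real.exp (-(δ / (2 * n)) * dx b) * M b) * (Real.exp (-(δ / n) * dy b b') * M b') := by
    intro b b'
    have hv : ∀ v ∈ V, (supNorm (v - v₀) : ℝ) ^ 2 *
          (|J b v₀| * |J b' v| * (M b * M b' * E₀ * Real.exp (-(2 * δ / n) * dy b b')))
        ≤ (3 * E₀ * C_J * M b * M b' * Real.exp (-(δ / (2 * n)) * dx b) * Real.exp (-(δ / n) * dy b b')) *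
            (((16 / δ ^ 2 + 4 / δ ^ 2) + (dz b' v / n) ^ 2) * |J b' v|) := by
      intro v _
      have hJ'0 : 0 ≤ |J b' v| := abs_nonneg _
      calc (supNorm (v - v₀) : ℝ) ^ 2 * (|J b v₀| * |J b' v| * (M b * M b' * E₀ * Real.exp (-(2 * δ / n) * dy b b')))
          ≤ (supNorm (v - v₀) : ℝ) ^ 2 *
              ((C_J * Real.exp (-(δ / n) * dx b)) * |J b' v| * (M b * M b' * E₀ * Real.exp (-(2 * δ / n) * dy b b'))) := by
            apply mul_le_mul_of_nonneg_left _ (by positivity)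
            exact mul_le_mul_of_nonneg_right (mul_le_mul_of_nonneg_right (hJ b) hJ'0)
              (mul_nonneg (mul_nonneg (mul_nonneg (hM0 b) (hM0 b')) hE₀0) (Real.exp_pos _).le)
        _ = (C_J * |J b' v| * (M b * M b' * E₀)) *
              ((supNorm (v - v₀) : ℝ) ^ 2 * (Real.exp (-(δ / n) * dx b) * Real.exp (-(2 * δ / n) * dy b b'))) := by ring
        _ ≤ (C_J * |J b' v| * (M b * M b' * E₀)) *
              (3 * ((16 / δ ^ 2 + 4 / δ ^ 2) + (dz b' v / n) ^ 2) *
                (Real.exp (-(δ / (2 * n)) * dx b) * Real.exp (-(δ / n) * dy b b'))) := by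
            apply mul_le_mul_of_nonneg_left (absorb b b' v)
            exact mul_nonneg (mul_nonneg hCJ hJ'0) (mul_nonneg (mul_nonneg (hM0 b) (hM0 b')) hE₀0)
        _ = _ := by ring
    refine (Finset.sum_le_sum hv).trans ?_
    rw [← Finset.mul_sum]
    -- Σ_v ((20/δ²) + (dz/n)²)|J b' v| ≤ (1 + 20/δ²) * C_J'
    have hsumv : ∑ v ∈ V, ((16 / δ ^ 2 + 4 / δ ^ 2) + (dz b' v / n) ^ 2) * |J b' v| ≤ (1 + 20 / δ ^ 2) * C_J' := by
      have hterm : ∀ v ∈ V, ((16 / δ ^ 2 + 4 / δ ^ 2) + (dz b' v / n) ^ 2) * |J b' v|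
          ≤ (1 + 20 / δ ^ 2) * ((1 + (dz b' v / n) ^ 2) * |J b' v|) := by
        intro v _
        have hz0 : 0 ≤ (dz b' v / n) ^ 2 := by positivity
        have hδ2 : 0 ≤ 20 / δ ^ 2 := by positivity
        rw [← mul_assoc]
        refine mul_le_mul_of_nonneg_right ?_ (abs_nonneg _)
        rw [show (1 + 20 / δ ^ 2) * (1 + (dz b' v / n) ^ 2)
          = (16 / δ ^ 2 + 4 / δ ^ 2 + (dz b' v / n) ^ 2) + (1 + 20 / δ ^ 2 * (dz b' v / n) ^ 2) by ring]
        linarith [mul_nonneg hδ2 hz0]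
      refine (Finset.sum_le_sum hterm).trans ?_
      rw [← Finset.mul_sum]
      exact mul_le_mul_of_nonneg_left (hJ' b') (by positivity)
    have hpre : 0 ≤ 3 * E₀ * C_J * M b * M b' * Real.exp (-(δ / (2 * n)) * dx b) * Real.exp (-(δ / n) * dy b b') :=
      mul_nonneg (mul_nonneg (mul_nonneg (mul_nonneg (mul_nonneg (mul_nonneg (by norm_num) hE₀0) hCJ) (hM0 b)) (hM0 b'))
        (Real.exp_pos _).le) (Real.exp_pos _).le
    calc (3 * E₀ * C_J * M b * M b' * Real.exp (-(δ / (2 * n)) * dx b) * Real.exp (-(δ / n) * dy b b')) *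
          ∑ v ∈ V, ((16 / δ ^ 2 + 4 / δ ^ 2) + (dz b' v / n) ^ 2) * |J b' v|
        ≤ (3 * E₀ * C_J * M b * M b' * Real.exp (-(δ / (2 * n)) * dx b) * Real.exp (-(δ / n) * dy b b')) *
          ((1 + 20 / δ ^ 2) * C_J') := mul_le_mul_of_nonneg_left hsumv hpre
      _ = _ := by ring
  -- STEP 4: sum over b' with (M) at centre b and rate δ/n ≥ δ/(2n), then over b with (M) at centre n•v₀
  have hMb' : ∀ b, ∑ b' ∈ S, Real.exp (-(δ / n) * dy b b') * M b' ≤ A_M := by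
    intro b
    have hrate : δ / (2 * n) ≤ δ / n := by rw [div_le_div_iff₀ (by positivity) hn']; nlinarith
    refine (Finset.sum_le_sum fun b' _ => mul_le_mul_of_nonneg_right (Real.exp_le_exp.mpr ?_) (hM0 b')).trans (hM' b)
    have h0 := hdy0 b b'
    show -(δ / n) * dy b b' ≤ -(δ / (2 * n)) * (supNorm (b' - b) : ℝ)
    simp only [hdy]; nlinarith
  have hMb : ∑ b ∈ S, Real.exp (-(δ / (2 * n)) * dx b) * M b ≤ A_M := by
    simpa only [hdx] using hM' ((n : ℤ) • v₀)
  have hK0 : 0 ≤ 3 * (1 + 20 / δ ^ 2) * E₀ * C_J * C_J' :=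
    mul_nonneg (mul_nonneg (mul_nonneg (mul_nonneg (by norm_num) (by positivity)) hE₀0) hCJ) hCJ'
  calc ∑ v ∈ V, (supNorm (v - v₀) : ℝ) ^ 2 * |∑ b ∈ S, ∑ b' ∈ S, J b v₀ * J b' v * k b b'|
      ≤ ∑ v ∈ V, ∑ b ∈ S, ∑ b' ∈ S, (supNorm (v - v₀) : ℝ) ^ 2 *
          (|J b v₀| * |J b' v| * (M b * M b' * E₀ * Real.exp (-(2 * δ / n) * dy b b'))) := Finset.sum_le_sum step1
    _ = ∑ b ∈ S, ∑ b' ∈ S, ∑ v ∈ V, (supNorm (v - v₀) : ℝ) ^ 2 *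
          (|J b v₀| * |J b' v| * (M b * M b' * E₀ * Real.exp (-(2 * δ / n) * dy b b'))) := by
        rw [Finset.sum_comm]
        refine Finset.sum_congr rfl fun b _ => ?_
        rw [Finset.sum_comm]
    _ ≤ ∑ b ∈ S, ∑ b' ∈ S, (3 * (1 + 20 / δ ^ 2) * E₀ * C_J * C_J') *
          (Real.exp (-(δ / (2 * n)) * dx b) * M b) * (Real.exp (-(δ / n) * dy b b') * M b') :=
        Finset.sum_le_sum fun b _ => Finset.sum_le_sum fun b' _ => step3 b b'
    _ = (3 * (1 + 20 / δ ^ 2) * E₀ * C_J * C_J') *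
          ∑ b ∈ S, (Real.exp (-(δ / (2 * n)) * dx b) * M b) * ∑ b' ∈ S, (Real.exp (-(δ / n) * dy b b') * M b') := by
        rw [Finset.mul_sum]
        refine Finset.sum_congr rfl fun b _ => ?_
        rw [Finset.mul_sum, Finset.mul_sum]
        refine Finset.sum_congr rfl fun b' _ => ?_
        ring
    _ ≤ (3 * (1 + 20 / δ ^ 2) * E₀ * C_J * C_J') * ∑ b ∈ S, (Real.exp (-(δ / (2 * n)) * dx b) * M b) * A_M := by
        apply mul_le_mul_of_nonneg_left _ hK0
        exact Finset.sum_le_sum fun b _ => mul_le_mul_of_nonneg_left (hMb' b) (mul_nonneg (Real.exp_pos _).le (hM0 b))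
    _ = (3 * (1 + 20 / δ ^ 2) * E₀ * C_J * C_J') * ((∑ b ∈ S, Real.exp (-(δ / (2 * n)) * dx b) * M b) * A_M) := by
        rw [Finset.sum_mul]
    _ ≤ (3 * (1 + 20 / δ ^ 2) * E₀ * C_J * C_J') * (A_M * A_M) := by
        apply mul_le_mul_of_nonneg_left _ hK0
        exact mul_le_mul_of_nonneg_right hMb hAM
    _ = 3 * (C_I * Real.exp (2 * R * δ)) ^ 2 * C_J * C_J' * (1 + 20 / δ ^ 2) * A_M ^ 2 := by
        rw [hE₀]; ring

end Mix2
end Summit.QuantumFields.BalabanUV.Beta.FP.MixLoopPowerCountingMass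
end
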